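import Literature.NumberTheory.Automorphic.QuaternionLocalEulerFactor
import Literature.NumberTheory.Automorphic.QuaternionLocalRamifiedStructure
import HarnessLib

/-!
# The norm-level density of a suborder, and the local Euler factor at a ramified prime

Topic `NumberTheory/Automorphic`; theorems only (no definition, no named fact, no instance).
Two complements to the unit-density computation of the local Euler factors
`∑_k a(p^k) p^{-2k}` of the zeta function of a `ℤ`-order `O` in a division quaternion algebra
over `ℚ` (`QuaternionLocalEulerFactor.lean`: the factor is `p⁴ / |O₍ₚ₎ˣ mod p|` as soon as the
density `|Y_R mod p^R O₍ₚ₎| / p^{4R}` of the complement `Y_R` of the norm levels `X_k`, `k < R`,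
tends to `0`):

* `tendsto_density_normLevel_compl_of_le` — **the density decay passes to suborders of finite
  index**: if `O ⊆ O'` are `ℤ`-orders with `[O' : O] < ∞` and the density for `O'` tends to `0`,
  so does the density for `O` (`Y_R(O) ⊆ Y_R(O')`, and a residue class modulo `p^R O'₍ₚ₎`
  splits into at most `[O'₍ₚ₎ : O₍ₚ₎]` classes modulo `p^R O₍ₚ₎`,
  `ncard_image_mk_le_relIndex_mul`). This supplies the decay for the Eichler orders
  `O = O₁ ∩ O₂ ⊆ O₁` at the primes dividing the level from the maximal (split) case
  `tendsto_density_normLevel_compl_of_split`.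
* `hasSum_card_principal_div_pow_of_ramified` — **the local factor at a ramified prime is
  `∑_k a(p^k) p^{-2k} = p⁴ / (p⁴ - p²) = (1 - p⁻²)⁻¹`** (`a(p^k) = 1`: the ideals are the
  `π^k O₍ₚ₎`), from `ncard_image_stabilizer_of_ramified` (`|O₍ₚ₎ˣ mod p| = p⁴ - p²`) and
  `ncard_image_normLevel_compl_of_ramified` (`|Y_R mod p^R| = p^{2R}`).

Both are inputs of Eichler's lattice-point method for the covolume of the unit group of an
Eichler order in an indefinite quaternion algebra over `ℚ`
(`Literature.NumberTheory.Automorphic.ShimuraCurveData.volume_fd_eq`; Vignéras IV §1, V §2) and of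
his mass formula (Voight §26.4, Lemma 26.6.7).

## References

* J. Voight, *Quaternion Algebras*, GTM 288 (2021), §26.4, Lemma 26.6.7 [Voight2021].
* M.-F. Vignéras, *Arithmétique des algèbres de quaternions*, LNM 800 (1980), Ch. II §1,
  Ch. V §2 [VignerasLNM800].
-/

open Filter Finset
open scoped Pointwise Topology

universe u

namespace Literature.NumberTheory.Automorphic

variable {B : Type u} [Ring B] [Algebra ℚ B] [IsQuaternionAlgebra ℚ B]

/-! ### Residues modulo nested subgroups -/

omit [Algebra ℚ B] [IsQuaternionAlgebra ℚ B] in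
/-- **A class modulo `K'` splits into at most `[K' : K ∩ K']` classes modulo `K`**: for
`T ⊆ B`, `|T mod K| ≤ [K' : K ∩ K'] · |T mod K'|` (when both counts are finite). [folklore] -/
theorem ncard_image_mk_le_relIndex_mul {K K' : AddSubgroup B}
    (hfin : K.relIndex K' ≠ 0) (T : Set B)
    (hT : (QuotientAddGroup.mk '' T : Set (B ⧸ K')).Finite) :
    (QuotientAddGroup.mk '' T : Set (B ⧸ K)).ncard ≤
      K.relIndex K' * (QuotientAddGroup.mk '' T : Set (B ⧸ K')).ncard := by
  classical
  set S' : Set (B ⧸ K') := QuotientAddGroup.mk '' T with hS'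
  set R' : Set (B ⧸ K) := QuotientAddGroup.mk '' (K' : Set B) with hR'
  have hR'card : R'.ncard = K.relIndex K' := ncard_image_mk_eq_relIndex K K'
  have hR'fin : R'.Finite := Set.finite_of_ncard_ne_zero (by rw [hR'card]; exact hfin)
  -- a section of `T → T mod K'`
  let s : B ⧸ K' → B := fun q => if h : q ∈ S' then ((Set.mem_image _ _ _).mp h).choose else 0
  have hs : ∀ q ∈ S', s q ∈ T ∧ (QuotientAddGroup.mk (s q) : B ⧸ K') = q := by
    intro q hq
    simp only [s, dif_pos hq]
    exact ((Set.mem_image _ _ _).mp hq).choose_spec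
  let F : (B ⧸ K') × (B ⧸ K) → B ⧸ K := fun qr => (QuotientAddGroup.mk (s qr.1) : B ⧸ K) + qr.2
  have hsub : (QuotientAddGroup.mk '' T : Set (B ⧸ K)) ⊆ F '' (S' ×ˢ R') := by
    rintro _ ⟨t, ht, rfl⟩
    have hq : (QuotientAddGroup.mk t : B ⧸ K') ∈ S' := ⟨t, ht, rfl⟩
    obtain ⟨-, hsq⟩ := hs _ hq
    have hk : -s (QuotientAddGroup.mk t) + t ∈ K' := QuotientAddGroup.eq.mp hsq
    refine ⟨(QuotientAddGroup.mk t, QuotientAddGroup.mk (-s (QuotientAddGroup.mk t) + t)),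
      ⟨hq, ⟨_, hk, rfl⟩⟩, ?_⟩
    simp only [F]
    rw [← QuotientAddGroup.mk_add, add_neg_cancel_left]
  have hprodfin : (S' ×ˢ R').Finite := hT.prod hR'fin
  calc (QuotientAddGroup.mk '' T : Set (B ⧸ K)).ncard
      ≤ (F '' (S' ×ˢ R')).ncard := Set.ncard_le_ncard hsub (hprodfin.image F)
    _ ≤ (S' ×ˢ R').ncard := Set.ncard_image_le hprodfin
    _ = S'.ncard * R'.ncard := Set.ncard_prod
    _ = K.relIndex K' * S'.ncard := by rw [hR'card, mul_comm]

/-! ### The density decay passes to suborders -/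

section Suborder

variable {p : ℕ} [hp : Fact p.Prime] {O O' : Submodule ℤ B} (hO : IsZOrder O) (hO' : IsZOrder O')
  (hle : O ≤ O')
include hO hO' hle

omit hle in
/-- For `O ⊆ O'`, a unit of `B` in `O₍ₚ₎` of norm level `k` for `O'` has norm level `k` for `O`
(both mean `v_p(nrd) = k`). [folklore] -/
theorem mem_normLevelUnits_of_le {k : ℕ} {z : Bˣ} (hz : (z : B) ∈ localAt p O)
    (hz' : z ∈ normLevelUnits p O' k) : z ∈ normLevelUnits p O k := by
  obtain ⟨k₁, hk₁, hidx⟩ := exists_relIndex_units_smul_localAt_eq_pow hO z hz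
  have hk : padicValRat p (reducedNorm ℚ B z) = k :=
    hO'.padicValRat_reducedNorm_of_mem_normLevelUnits hz'
  have hkk : k₁ = k := by
    have : ((k₁ : ℕ) : ℤ) = k := by rw [← hk₁, hk]
    exact_mod_cast this
  exact ⟨hz, by rw [hidx, hkk]⟩

/-- `Y_R(O) ⊆ Y_R(O')`: the complement of the norm levels `k < R` in `O₍ₚ₎` lies in the
corresponding complement for `O' ⊇ O`. [folklore] -/
theorem normLevel_compl_subset_of_le (R : ℕ) :
    ((localAt p O : Set B) \ ⋃ k ∈ range R, Units.val '' normLevelUnits p O k) ⊆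
      ((localAt p O' : Set B) \ ⋃ k ∈ range R, Units.val '' normLevelUnits p O' k) := by
  rintro x ⟨hx, hxn⟩
  refine ⟨localAt_mono p hle hx, fun h => hxn ?_⟩
  simp only [Set.mem_iUnion, Set.mem_image] at h ⊢
  obtain ⟨k, hk, z, hz, rfl⟩ := h
  exact ⟨k, hk, z, mem_normLevelUnits_of_le hO hO' hx hz, rfl⟩

/-- **The density decay passes to suborders of finite index**: if `O ⊆ O'` are `ℤ`-orders with
`[O' : O] ≠ 0` and `|Y_R(O') mod p^R O'₍ₚ₎| / p^{4R} → 0`, then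
`|Y_R(O) mod p^R O₍ₚ₎| / p^{4R} → 0`. [cite: Voight2021, Lemma 26.6.7] -/
theorem tendsto_density_normLevel_compl_of_le
    (hidx : O.toAddSubgroup.relIndex O'.toAddSubgroup ≠ 0)
    (h' : Tendsto (fun R : ℕ => ((QuotientAddGroup.mk '' ((localAt p O' : Set B) \ ⋃ k ∈ range R,
        Units.val '' normLevelUnits p O' k) :
      Set (B ⧸ (((p : ℤ) ^ R) • localAt p O').toAddSubgroup)).ncard : ℝ) / (p : ℝ) ^ (4 * R))
      atTop (𝓝 0)) :
    Tendsto (fun R : ℕ => ((QuotientAddGroup.mk '' ((localAt p O : Set B) \ ⋃ k ∈ range R,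
        Units.val '' normLevelUnits p O k) :
      Set (B ⧸ (((p : ℤ) ^ R) • localAt p O).toAddSubgroup)).ncard : ℝ) / (p : ℝ) ^ (4 * R))
      atTop (𝓝 0) := by
  classical
  have hpp : p.Prime := hp.out
  have hpR : (0 : ℝ) < p := by exact_mod_cast hpp.pos
  -- the constant `C = [O'₍ₚ₎ : O₍ₚ₎]`
  set C : ℕ := (localAt p O).toAddSubgroup.relIndex (localAt p O').toAddSubgroup with hC
  have hCval : C = p ^ (O.toAddSubgroup.relIndex O'.toAddSubgroup).factorization p :=
    relIndex_localAt O' O hle hidx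
  have hC0 : C ≠ 0 := by rw [hCval]; exact pow_ne_zero _ hpp.ne_zero
  -- the comparison of counts
  have hcount : ∀ R : ℕ,
      (QuotientAddGroup.mk '' ((localAt p O : Set B) \ ⋃ k ∈ range R,
          Units.val '' normLevelUnits p O k) :
        Set (B ⧸ (((p : ℤ) ^ R) • localAt p O).toAddSubgroup)).ncard ≤
      C * (QuotientAddGroup.mk '' ((localAt p O' : Set B) \ ⋃ k ∈ range R,
          Units.val '' normLevelUnits p O' k) :
        Set (B ⧸ (((p : ℤ) ^ R) • localAt p O').toAddSubgroup)).ncard := by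
    intro R
    set T : Set B := (localAt p O : Set B) \ ⋃ k ∈ range R, Units.val '' normLevelUnits p O k
      with hT
    set K : AddSubgroup B := (((p : ℤ) ^ R) • localAt p O).toAddSubgroup with hK
    set K' : AddSubgroup B := (((p : ℤ) ^ R) • localAt p O').toAddSubgroup with hK'
    have hKidx : K.relIndex K' = C := by
      rw [hK, hK', hC]
      exact relIndex_intCast_smul_intCast_smul (pow_ne_zero R (by exact_mod_cast hpp.ne_zero)) _ _
    have hfin' : (QuotientAddGroup.mk '' (localAt p O' : Set B) : Set (B ⧸ K')).Finite :=
      hO'.finite_image_mk_localAt R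
    have hTsub : T ⊆ (localAt p O' : Set B) := fun x hx => localAt_mono p hle hx.1
    have hTfin : (QuotientAddGroup.mk '' T : Set (B ⧸ K')).Finite :=
      hfin'.subset (Set.image_mono hTsub)
    have h1 := ncard_image_mk_le_relIndex_mul (by rw [hKidx]; exact hC0) T hTfin
    rw [hKidx] at h1
    refine h1.trans (Nat.mul_le_mul_left C ?_)
    refine Set.ncard_le_ncard (Set.image_mono (normLevel_compl_subset_of_le hO hO' hle R)) ?_
    exact hfin'.subset (Set.image_mono fun x hx => hx.1)
  -- squeeze
  have h2 : Tendsto (fun R : ℕ => (C : ℝ) * (((QuotientAddGroup.mk '' ((localAt p O' : Set B) \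
      ⋃ k ∈ range R, Units.val '' normLevelUnits p O' k) :
        Set (B ⧸ (((p : ℤ) ^ R) • localAt p O').toAddSubgroup)).ncard : ℝ) / (p : ℝ) ^ (4 * R)))
      atTop (𝓝 0) := by
    simpa only [mul_zero] using h'.const_mul (C : ℝ)
  refine tendsto_of_tendsto_of_tendsto_of_le_of_le tendsto_const_nhds h2
    (fun R => by positivity) (fun R => ?_)
  have hp4 : (0 : ℝ) < (p : ℝ) ^ (4 * R) := pow_pos hpR _
  rw [mul_div_assoc']
  refine div_le_div_of_nonneg_right ?_ hp4.le
  rw [← Nat.cast_mul]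
  exact Nat.cast_le.mpr (hcount R)

end Suborder

/-! ### The local Euler factor at a ramified prime -/

section Ramified

variable {p : ℕ} [hp : Fact p.Prime]

/-- **The local Euler factor at a ramified prime**: for a `ℤ`-order `O` of a division quaternion
algebra over `ℚ` whose localisation at `p` is the valuation ring `{nrd ∈ ℤ₍ₚ₎}` (the maximal
order at a ramified prime, and every Eichler order there),
`∑_k a(p^k) p^{-2k} = p⁴ / (p⁴ - p²) = (1 - p⁻²)⁻¹`, `a(p^k)` the number of principal right
ideals of `O₍ₚ₎` of index `p^{2k}` (all equal to `1`). [cite: Voight2021, §26.4, (25.3.7)] -/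
theorem hasSum_card_principal_div_pow_of_ramified (hdiv : ∀ x : B, x ≠ 0 → IsUnit x)
    {O : Submodule ℤ B} (hO : IsZOrder O)
    (hΛ : ∀ x : B, x ∈ localAt p O ↔ ¬ p ∣ (reducedNorm ℚ B x).den) :
    HasSum (fun k => (Nat.card {N : Submodule ℤ B // (∃ z : Bˣ, (z : B) ∈ localAt p O ∧
        N = z • localAt p O) ∧ N.toAddSubgroup.relIndex (localAt p O).toAddSubgroup = p ^ (2 * k)} : ℝ) /
        (p : ℝ) ^ (2 * k))
      ((p : ℝ) ^ 4 / ((p : ℝ) ^ 4 - (p : ℝ) ^ 2)) := by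
  have hpp : p.Prime := hp.out
  have hpR : (0 : ℝ) < p := by exact_mod_cast hpp.pos
  have hp1 : (1 : ℝ) < p := by exact_mod_cast hpp.one_lt
  -- the density `p^{2R} / p^{4R} → 0`
  have hY : Tendsto (fun R : ℕ => ((QuotientAddGroup.mk '' ((localAt p O : Set B) \ ⋃ k ∈ range R,
        Units.val '' normLevelUnits p O k) :
      Set (B ⧸ (((p : ℤ) ^ R) • localAt p O).toAddSubgroup)).ncard : ℝ) / (p : ℝ) ^ (4 * R))
      atTop (𝓝 0) := by
    have hval : ∀ R : ℕ, ((QuotientAddGroup.mk '' ((localAt p O : Set B) \ ⋃ k ∈ range R,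
        Units.val '' normLevelUnits p O k) :
      Set (B ⧸ (((p : ℤ) ^ R) • localAt p O).toAddSubgroup)).ncard : ℝ) / (p : ℝ) ^ (4 * R) =
        (((p : ℝ) ^ 2)⁻¹) ^ R := by
      intro R
      rw [ncard_image_normLevel_compl_of_ramified hdiv hO hΛ R, Nat.cast_pow, inv_pow, ← pow_mul,
        eq_comm, inv_eq_one_div, div_eq_div_iff (pow_ne_zero _ hpR.ne') (pow_ne_zero _ hpR.ne'),
        one_mul, ← pow_add]
      congr 1
      ring
    simp_rw [hval]
    exact tendsto_pow_atTop_nhds_zero_of_lt_one (by positivity)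
      (inv_lt_one_of_one_lt₀ (one_lt_pow₀ hp1 two_ne_zero))
  have h := hO.hasSum_card_principal_div_pow (p := p) hY
  rw [ncard_image_stabilizer_of_ramified hdiv hO hΛ] at h
  have hcast : (((p ^ 4 - p ^ 2 : ℕ)) : ℝ) = (p : ℝ) ^ 4 - (p : ℝ) ^ 2 := by
    have hle : p ^ 2 ≤ p ^ 4 := Nat.pow_le_pow_right hpp.pos (by norm_num)
    push_cast [Nat.cast_sub hle]
    ring
  rwa [hcast] at h

end Ramified

end Literature.NumberTheory.Automorphic
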